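import Summits.QuantumFields.BalabanUV.Beta.EriceFlowEnclosureBorelNevanlinna
import Summits.QuantumFields.BalabanUV.Beta.EriceFlowEnclosureBorelNevanlinnaConverse

/-!
# Beta / EriceFlowEnclosureBorelNevanlinnaCorrespondence — NEVANLINNA'S THEOREM IS A CORRESPONDENCE (disc ∕ strip form): the two halves
# 36f `nevanlinna_disc` (f ↦ B: disc ⟹ strip) and 37e `nevanlinna_disc_converse` (B ↦ f: strip ⟹ disc) COMPOSE — 37e's output meets
# 36f's hypotheses verbatim — and are MUTUALLY INVERSE: f ↦ B ↦ f is 36f (iv) as printed, and B ↦ f ↦ B′ returns `B′ = B` on the common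
# disc ∪ half-strip (uniqueness of the holomorphic function with given Borel letters on the star-shaped region `ball ∪ strip`)
# (bflow-p3 gen 40, MODULE 37f over 36f ∕ 37e ∕ 35d; Mathlib + tree only)

HONEST FRAMING (page 1 of everything the β sub-cell writes): discharging `BetaPertH` makes Bałaban's UV stability UNCONDITIONAL — a
real constructive-QFT result; it is NOT the continuum limit and NOT the Clay problem.  HONEST DEPENDENCY (cell reorg 2026-08-19,
verbatim): «continuum YM on T⁴ ⇐ BetaPertH ∧ nine spine estimates (0/9 proved); BetaPertH ⇐ (D1) ∧ (D4) ∧ CAP+tail; G-an2-4 gates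
asym, D1 and NE2/3/4.»  THIS MODULE DISCHARGES NOTHING: [folklore] one-variable complex analysis over Mathlib and the tree (no
β-function, no flow, no Erice sentence is used).

SOURCE (shapes only).  [LodayRichaud2016] Thm 5.3.9 p. 156 («the following two assumptions are equivalent» (i), (ii); «Moreover, the functions f(x) and
φ(ξ) are k-Laplace and k-Borel transforms of each other»);
[Rivasseau1991] Thm I.5.1 pp. 55–56 (the theorem and its «reciprocal»).

WHAT THIS FILE PROVES (0 sorry, 0 def).  `isOpen_convex_strip`, `isPreconnected_ball_union_strip` (star about `ρ∕2`),
**`borelTransform_unique_strip`** (two functions holomorphic on `ball 0 ρ ∪ {0 < Re τ, |Im τ| < κ}` with the same Borel letters on the ball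
coincide), HEADLINE **`nevanlinna_roundtrip`**: for `B` as in 37e and `δ > 0` THERE IS `K > 0` such that Nevanlinna's construction 36f,
applied to `f = z⁻¹∫₀^∞e^{−t∕z}B(t)dt` on the disc `{Re z⁻¹ > c + δ}` (where 37e puts the uniform Gevrey-1 bound), yields a `B′`
holomorphic on `ball 0 K⁻¹ ∪ {0 < Re τ, |Im τ| < K⁻¹}`, summing `Σ B⁽ⁿ⁾(0)τⁿ∕n!`, Laplace-representing `f` — AND `B′ = B` on
`ball 0 (min R₀ K⁻¹) ∪ {0 < Re τ, |Im τ| < min η K⁻¹}`; and **`nevanlinna_disc_converse_of_growth`**: 37e's END without the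
ball bound `‖B‖ ≤ M` (free on `‖τ‖ ≤ R₀∕2` by compactness) and without `A ≥ 0` — analyticity + strip growth alone.
NOT CLAIMED: anything about Erice's β; `BetaPertH`, continuum, Clay.
-/

namespace Summit.QuantumFields.BalabanUV.Beta.EriceFlowEnclosureBorelNevanlinnaCorrespondence

open Set Filter Topology MeasureTheory Metric Complex
open scoped Real Nat
open Summit.QuantumFields.BalabanUV.Beta.EriceFlowEnclosureBorelNevanlinna (nevanlinna_disc)
open Summit.QuantumFields.BalabanUV.Beta.EriceFlowEnclosureBorelNevanlinnaConverse (nevanlinna_disc_converse)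
open Summit.QuantumFields.BalabanUV.Beta.EriceFlowEnclosureBorelCorrespondence (hasSum_taylor_letters)

noncomputable section

/-- The half-strip `{0 < Re τ, |Im τ| < κ}` is open and convex (three half-planes). [folklore] -/
theorem isOpen_convex_strip (κ : ℝ) :
    IsOpen {τ : ℂ | 0 < τ.re ∧ |τ.im| < κ} ∧ Convex ℝ {τ : ℂ | 0 < τ.re ∧ |τ.im| < κ} := by
  refine ⟨(isOpen_lt continuous_const Complex.continuous_re).inter
    (isOpen_lt (continuous_abs.comp Complex.continuous_im) continuous_const), ?_⟩
  have hl1 : IsLinearMap ℝ fun w : ℂ => w.re := ⟨fun x y => by simp, fun c x => by simp⟩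
  have hl2 : IsLinearMap ℝ fun w : ℂ => w.im := ⟨fun x y => by simp, fun c x => by simp⟩
  have e : {τ : ℂ | 0 < τ.re ∧ |τ.im| < κ} = {w : ℂ | 0 < w.re} ∩ ({w : ℂ | w.im < κ} ∩ {w : ℂ | -κ < w.im}) := by
    ext w; simp only [Set.mem_setOf_eq, Set.mem_inter_iff, abs_lt]; tauto
  rw [e]
  exact (convex_halfSpace_gt hl1 0).inter ((convex_halfSpace_lt hl2 _).inter (convex_halfSpace_gt hl2 _))

/-- `ball 0 ρ ∪ {0 < Re τ, |Im τ| < κ}` is preconnected (`ρ, κ > 0`: the two convex pieces share the point `ρ∕2`). [folklore] -/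
theorem isPreconnected_ball_union_strip {ρ κ : ℝ} (hρ : 0 < ρ) (hκ : 0 < κ) :
    IsPreconnected (ball (0 : ℂ) ρ ∪ {τ : ℂ | 0 < τ.re ∧ |τ.im| < κ}) := by
  have hball : (((ρ / 2 : ℝ)) : ℂ) ∈ ball (0 : ℂ) ρ := by
    rw [mem_ball_zero_iff, Complex.norm_real, Real.norm_of_nonneg (by positivity)]; linarith
  have hstrip : (((ρ / 2 : ℝ)) : ℂ) ∈ {τ : ℂ | 0 < τ.re ∧ |τ.im| < κ} := by
    refine ⟨?_, ?_⟩
    · rw [Complex.ofReal_re]; positivity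
    · rw [Complex.ofReal_im, abs_zero]; exact hκ
  exact (convex_ball _ _).isPreconnected.union _ hball hstrip (isOpen_convex_strip κ).2.isPreconnected

/-- **Uniqueness of the Borel function on disc ∪ half-strip**: two functions holomorphic on `ball 0 ρ ∪ {0 < Re τ, |Im τ| < κ}` which sum
the same Borel series `Σ a_n τⁿ∕n!` on the ball coincide on the whole region (identity theorem). [folklore] -/
theorem borelTransform_unique_strip {a : ℕ → ℂ} {ρ κ : ℝ} (hρ : 0 < ρ) (hκ : 0 < κ) {B₁ B₂ : ℂ → ℂ}
    (h₁ : DifferentiableOn ℂ B₁ (ball (0 : ℂ) ρ ∪ {τ : ℂ | 0 < τ.re ∧ |τ.im| < κ}))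
    (h₂ : DifferentiableOn ℂ B₂ (ball (0 : ℂ) ρ ∪ {τ : ℂ | 0 < τ.re ∧ |τ.im| < κ}))
    (hs₁ : ∀ τ : ℂ, ‖τ‖ < ρ → HasSum (fun n : ℕ => a n * (τ ^ n / (n ! : ℂ))) (B₁ τ))
    (hs₂ : ∀ τ : ℂ, ‖τ‖ < ρ → HasSum (fun n : ℕ => a n * (τ ^ n / (n ! : ℂ))) (B₂ τ)) :
    EqOn B₁ B₂ (ball (0 : ℂ) ρ ∪ {τ : ℂ | 0 < τ.re ∧ |τ.im| < κ}) := by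
  have hDo : IsOpen (ball (0 : ℂ) ρ ∪ {τ : ℂ | 0 < τ.re ∧ |τ.im| < κ}) := isOpen_ball.union (isOpen_convex_strip κ).1
  have h0 : (0 : ℂ) ∈ ball (0 : ℂ) ρ := mem_ball_self hρ
  have heq : B₁ =ᶠ[𝓝 (0 : ℂ)] B₂ := by
    filter_upwards [isOpen_ball.mem_nhds h0] with τ hτ
    exact (hs₁ τ (mem_ball_zero_iff.mp hτ)).unique (hs₂ τ (mem_ball_zero_iff.mp hτ))
  exact (h₁.analyticOnNhd hDo).eqOn_of_preconnected_of_eventuallyEq (h₂.analyticOnNhd hDo)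
    (isPreconnected_ball_union_strip hρ hκ) (Or.inl h0) heq

/-- **NEVANLINNA'S THEOREM IS A CORRESPONDENCE: B ↦ f ↦ B′ = B.**  Let `B` be holomorphic on `ball 0 R₀ ∪ {0 < Re τ, |Im τ| < η}`
(`R₀, η > 0`) with `‖B‖ ≤ M` on the ball and `‖B τ‖ ≤ A·e^{c·Re τ}` on the half-strip (`c, A ≥ 0`), and let `δ > 0`.  Then there is
`K > 0` and a function `B′` — the one Nevanlinna's theorem 36f `nevanlinna_disc` constructs from `f(z) = z⁻¹∫₀^∞e^{−t∕z}B(t)dt` on the disc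
`{Re z⁻¹ > c + δ}`, where 37e `nevanlinna_disc_converse` supplies 36f's hypotheses — with: `B′` holomorphic on
`ball 0 K⁻¹ ∪ {0 < Re τ, |Im τ| < K⁻¹}`, `HasSum (B⁽ⁿ⁾(0)τⁿ∕n!) (B′ τ)` on `‖τ‖ < K⁻¹`, `f z = z⁻¹∫₀^∞e^{−t∕z}B′(t)dt` on the disc, and
**`B′ = B` on `ball 0 (min R₀ K⁻¹) ∪ {0 < Re τ, |Im τ| < min η K⁻¹}`**.  (The other composition, f ↦ B ↦ f, is 36f (iv).)
[cite: LodayRichaud2016, Thm 5.3.9 (i)⟺(ii)] [cite: Rivasseau1991, Thm I.5.1 and reciprocal] -/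
theorem nevanlinna_roundtrip {B : ℂ → ℂ} {R₀ η M A c δ : ℝ} (hR₀ : 0 < R₀) (hη : 0 < η) (hc : 0 ≤ c) (hA : 0 ≤ A) (hδ : 0 < δ)
    (hBd : DifferentiableOn ℂ B (ball (0 : ℂ) R₀ ∪ {τ : ℂ | 0 < τ.re ∧ |τ.im| < η}))
    (hBM : ∀ τ ∈ ball (0 : ℂ) R₀, ‖B τ‖ ≤ M)
    (hBg : ∀ τ : ℂ, 0 < τ.re → |τ.im| < η → ‖B τ‖ ≤ A * Real.exp (c * τ.re)) :
    ∃ K : ℝ, 0 < K ∧ ∃ B' : ℂ → ℂ,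
      DifferentiableOn ℂ B' (ball (0 : ℂ) K⁻¹ ∪ {τ : ℂ | 0 < τ.re ∧ |τ.im| < K⁻¹}) ∧
      (∀ τ : ℂ, ‖τ‖ < K⁻¹ → HasSum (fun n : ℕ => iteratedDeriv n B 0 * (τ ^ n / (n ! : ℂ))) (B' τ)) ∧
      (∀ z : ℂ, c + δ < (z⁻¹).re →
        IntegrableOn (fun t : ℝ => cexp (-(t : ℂ) * z⁻¹) * B' t) (Ioi 0) ∧
        z⁻¹ * (∫ t in Ioi (0 : ℝ), cexp (-(t : ℂ) * z⁻¹) * B t) = z⁻¹ * ∫ t in Ioi (0 : ℝ), cexp (-(t : ℂ) * z⁻¹) * B' t) ∧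
      EqOn B' B (ball (0 : ℂ) (min R₀ K⁻¹) ∪ {τ : ℂ | 0 < τ.re ∧ |τ.im| < min η K⁻¹}) := by
  obtain ⟨hhol, hmain⟩ := nevanlinna_disc_converse hR₀ hη hc hA hBd hBM hBg
  obtain ⟨C, K, hC, hK, hgev⟩ := hmain δ hδ
  -- 36f's hypotheses on the disc `{Re z⁻¹ > 1∕r}`, `r = 1∕(c + δ)`
  have hcδ : 0 < c + δ := by linarith
  set r : ℝ := 1 / (c + δ) with hr
  have hrpos : 0 < r := by positivity
  have h1r : 1 / r = c + δ := by rw [hr, one_div_one_div]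
  set f : ℂ → ℂ := fun z : ℂ => z⁻¹ * ∫ t in Ioi (0 : ℝ), cexp (-(t : ℂ) * z⁻¹) * B t with hf
  have hfd : DifferentiableOn ℂ f {z : ℂ | 1 / r < (z⁻¹).re} :=
    hhol.mono fun z (hz : 1 / r < (z⁻¹).re) => show c < (z⁻¹).re by rw [h1r] at hz; linarith
  have hfgev : ∀ N : ℕ, ∀ z ∈ {z : ℂ | 1 / r < (z⁻¹).re},
      ‖f z - ∑ n ∈ Finset.range N, iteratedDeriv n B 0 * z ^ n‖ ≤ C * K ^ N * N ! * ‖z‖ ^ N := by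
    intro N z hz
    have hz' : 1 / r < (z⁻¹).re := hz
    rw [h1r] at hz'
    exact (hgev z hz'.le).2 N
  have hrate : 1 / r < c + δ + 1 := by rw [h1r]; linarith
  obtain ⟨B', hB'd, hB's, -, hB'L⟩ := nevanlinna_disc hrpos hK hrate hfd hfgev
  refine ⟨K, hK, B', hB'd, hB's, fun z hz => ?_, ?_⟩
  · have hz' : 1 / r < (z⁻¹).re := by rw [h1r]; exact hz
    exact hB'L z hz'
  · -- uniqueness on the common region
    have hρ : 0 < min R₀ K⁻¹ := lt_min hR₀ (inv_pos.mpr hK)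
    have hκ : 0 < min η K⁻¹ := lt_min hη (inv_pos.mpr hK)
    have hsub1 : ball (0 : ℂ) (min R₀ K⁻¹) ∪ {τ : ℂ | 0 < τ.re ∧ |τ.im| < min η K⁻¹} ⊆
        ball (0 : ℂ) K⁻¹ ∪ {τ : ℂ | 0 < τ.re ∧ |τ.im| < K⁻¹} :=
      union_subset_union (ball_subset_ball (min_le_right _ _)) fun τ hτ => ⟨hτ.1, hτ.2.trans_le (min_le_right _ _)⟩
    have hsub2 : ball (0 : ℂ) (min R₀ K⁻¹) ∪ {τ : ℂ | 0 < τ.re ∧ |τ.im| < min η K⁻¹} ⊆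
        ball (0 : ℂ) R₀ ∪ {τ : ℂ | 0 < τ.re ∧ |τ.im| < η} :=
      union_subset_union (ball_subset_ball (min_le_left _ _)) fun τ hτ => ⟨hτ.1, hτ.2.trans_le (min_le_left _ _)⟩
    refine borelTransform_unique_strip (a := fun n => iteratedDeriv n B 0) hρ hκ (hB'd.mono hsub1) (hBd.mono hsub2)
      (fun τ hτ => hB's τ (hτ.trans_le (min_le_right _ _))) fun τ hτ => ?_
    exact hasSum_taylor_letters (hBd.mono subset_union_left) (hτ.trans_le (min_le_left _ _))

/-- **The converse without the ball bound (and without `A ≥ 0`).**  The sup of `‖B‖` on the smaller ball `‖τ‖ < R₀∕2` comes for free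
(compactness of the closed ball, continuity of `B`) and `A ≥ 0` from the growth at `τ = 1`, so analyticity on
`ball 0 R₀ ∪ {0 < Re τ, |Im τ| < η}` and the strip growth `‖B τ‖ ≤ A·e^{c·Re τ}` (`c ≥ 0`) ALONE give the
conclusion of 37e `nevanlinna_disc_converse`: holomorphy of `z ↦ z⁻¹∫₀^∞e^{−t∕z}B(t)dt` on `{Re z⁻¹ > c}` and, for every `δ > 0`, the uniform
Gevrey-1 bound with letters `B⁽ⁿ⁾(0)` on `{Re z⁻¹ ≥ c + δ}`. [cite: LodayRichaud2016, Thm 5.3.9 (i)⇒(ii)] -/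
theorem nevanlinna_disc_converse_of_growth {B : ℂ → ℂ} {R₀ η A c : ℝ} (hR₀ : 0 < R₀) (hη : 0 < η) (hc : 0 ≤ c)
    (hBd : DifferentiableOn ℂ B (ball (0 : ℂ) R₀ ∪ {τ : ℂ | 0 < τ.re ∧ |τ.im| < η}))
    (hBg : ∀ τ : ℂ, 0 < τ.re → |τ.im| < η → ‖B τ‖ ≤ A * Real.exp (c * τ.re)) :
    DifferentiableOn ℂ (fun z : ℂ => z⁻¹ * ∫ t in Ioi (0 : ℝ), cexp (-(t : ℂ) * z⁻¹) * B t) {z : ℂ | c < (z⁻¹).re} ∧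
    ∀ δ : ℝ, 0 < δ → ∃ C K : ℝ, 0 ≤ C ∧ 0 < K ∧ ∀ z : ℂ, c + δ ≤ (z⁻¹).re →
      IntegrableOn (fun t : ℝ => cexp (-(t : ℂ) * z⁻¹) * B t) (Ioi 0) ∧
      ∀ N : ℕ, ‖z⁻¹ * (∫ t in Ioi (0 : ℝ), cexp (-(t : ℂ) * z⁻¹) * B t) -
        ∑ n ∈ Finset.range N, iteratedDeriv n B 0 * z ^ n‖ ≤ C * K ^ N * N ! * ‖z‖ ^ N := by
  have hA : 0 ≤ A := by
    have h := (norm_nonneg _).trans (hBg 1 (by simp) (by simpa using hη))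
    exact (mul_nonneg_iff_of_pos_right (Real.exp_pos _)).mp h
  obtain ⟨M, hM⟩ := (isCompact_closedBall (0 : ℂ) (R₀ / 2)).exists_bound_of_continuousOn
    ((hBd.mono subset_union_left).continuousOn.mono (closedBall_subset_ball (by linarith)))
  have hBd' : DifferentiableOn ℂ B (ball (0 : ℂ) (R₀ / 2) ∪ {τ : ℂ | 0 < τ.re ∧ |τ.im| < η}) :=
    hBd.mono (union_subset_union_left _ (ball_subset_ball (by linarith)))
  exact nevanlinna_disc_converse (by positivity) hη hc hA hBd' (fun τ hτ => hM τ (ball_subset_closedBall hτ)) hBg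

end

end Summit.QuantumFields.BalabanUV.Beta.EriceFlowEnclosureBorelNevanlinnaCorrespondence
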